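import Mathlib
import HarnessLib
import Summits.ValiantsHypothesis.ValiantsHypothesis.Theses.MonotoneRestoration
import Literature.Computability.AlgebraicComplexity.ArithCircuit
import Literature.Computability.AlgebraicComplexity.ArithCircuitProofs
import Literature.Computability.AlgebraicComplexity.MonotoneStructure
import Literature.Computability.AlgebraicComplexity.PermanentIrreducible
import Literature.ModelTheory.FiniteModelTheory.CkEquiv
import Summits.ValiantsHypothesis.ValiantsHypothesis.Theorems.MonotoneRestorationMonotoneRestorationQPCosetCount
import Summits.ValiantsHypothesis.ValiantsHypothesis.Theorems.MonotoneRestorationMonotoneRestorationQPSymmetricLB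
import Summits.ValiantsHypothesis.ValiantsHypothesis.Theorems.MonotoneRestorationMonotoneRestorationQPSupportSymmetrisation
import Summits.ValiantsHypothesis.ValiantsHypothesis.Theorems.MonotoneRestorationMonotoneRestorationQPSparseRegime
import Summits.ValiantsHypothesis.ValiantsHypothesis.Theorems.MonotoneRestorationMonotoneRestorationQPBeta
import Literature.Computability.AlgebraicComplexity.SymmetricArithCircuit
import Literature.Computability.AlgebraicComplexity.DawarWilsenach2025Proofs
import Literature.GroupTheory.PermutationGroups.SmallIndexSubgroups
import Summits.ValiantsHypothesis.ValiantsHypothesis.Theorems.MonotoneRestorationQP.Negative.LoadBearing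
import Summits.ValiantsHypothesis.ValiantsHypothesis.Theorems.MonotoneRestorationMonotoneRestorationQPPermSupportCount

/-! TTRL-lite variant V19211 of stmt-ValiantsHypothesis-15886 -/

-- `Summit.ValiantsHypothesis.ValiantsHypothesis.…` is the tree's mandated single-conjunct layout
-- (Sub = Summit), so the duplicated namespace component is intended.
set_option linter.dupNamespace false

namespace Summit.ValiantsHypothesis.ValiantsHypothesis.Theorems

open Summit.ValiantsHypothesis.ValiantsHypothesis.Theses.MonotoneRestoration
open Literature.Computability.AlgebraicComplexity

/-- **TTRL-lite variant V19211 (boundary probe, FALSE)** of `stub_esymmRowSums_structure`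
(`stmt-ValiantsHypothesis-15886`): it is *not* the case that for every `n` the elementary symmetric
polynomial `e_{⌊n/2⌋}` of the row sums `R_i = Σ_j x_{i,j}` is fully ordered (set-multilinear on all
`n` rows, `IsFullyOrdered`). Witness `n = 1`: `⌊1/2⌋ = 0`, so the polynomial is `e_0 = 1 = C 1`, a
nonzero constant, whose unique monomial `0` has row degree `0 ≠ 1` in row `0`
(`not_isFullyOrdered_C`). (For `n ≥ 2` every monomial has degree `⌊n/2⌋ < n` and so misses a row as
well.) This marks why CDGM's ordered structure theorem does not apply verbatim to this witness.
[folklore] -/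
theorem stub_esymmRowSums_structure_var19211_false :
    ¬ (∀ (n : ℕ), IsFullyOrdered (MvPolynomial.bind₁ (fun i : Fin n => ∑ j : Fin n,
      MvPolynomial.X (i, j)) (MvPolynomial.esymm (Fin n) NNReal (n / 2)))) := by
  intro h
  have h1 : IsFullyOrdered (MvPolynomial.bind₁ (fun i : Fin 1 => ∑ j : Fin 1,
      (MvPolynomial.X (i, j) : MvPolynomial (Fin 1 × Fin 1) NNReal))
        (MvPolynomial.esymm (Fin 1) NNReal 0)) := h 1
  rw [MvPolynomial.esymm_zero, map_one, ← MvPolynomial.C_1] at h1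
  exact not_isFullyOrdered_C (ι := Fin 1) (κ := Fin 1) one_ne_zero h1

end Summit.ValiantsHypothesis.ValiantsHypothesis.Theorems
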